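import Summits.NavierStokesRegularity.NavierStokesRegularity.Theorems.ExtremiserTransienceNearExtremalTransienceExtremiserLiouvilleConstantSpeedEnergyFlux
import Literature.Analysis.Calculus.SmoothCutoff
import HarnessLib

/-!
# Crux `ExtremiserTransience.NearExtremalTransience` (stmt-NavierStokesRegularity-21883), line `extremiser_liouville`,
# stub K1b — ENERGY-FLUX INVARIANCE of the residue object, part 2: the identity `∫ θ′(x₂)‖w − c‖² = 0` and constancy of the window energies

`--supports stmt-NavierStokesRegularity-21883` (helper).  Author: prover seat `ns-el-k1b` (g5).  Continues
`…ConstantSpeedEnergyFlux` (the estimate `|∫ θ′(x₂)χ_ρ‖V‖²| ≤ K(η·tail + T/η)`).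

For `V = w − c ∈ C¹` divergence free with `⟪V, c⟫ = −‖V‖²/2` (constant speed `‖w‖ ≡ ‖c‖`), `c = (0,0,c₂) ≠ 0`:

* `integral_deriv_axialTest_mul_sq_eq_zero` : **`∫ θ′(x₂) ‖V x‖² dx = 0`** for every axial test `θ ∈ C¹` supported in
  `(−T, T)`, as soon as `‖V‖² ∈ L¹({|x₂| ≤ T})` (letting `ρ → ∞`, `η → ∞` in part 1);
* `integral_deriv_smoothTransition_mul_sq_eq` : **ENERGY-FLUX INVARIANCE** — with `H = Real.smoothTransition` the window
  energies `E(s) := ∫ H′(x₂ − s)‖V x‖² dx` (unit-mass averages of the plane energies `z ↦ ∫_{ℝ²}‖V(·, z)‖²` over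
  `s ≤ z ≤ s + 1`) satisfy `E(s) = E(t)` whenever `|s| + 1, |t| + 1 ≤ T` and `‖V‖² ∈ L¹({|x₂| ≤ T})`;
* small facts on the window weight `H′` (`exists_deriv_smoothTransition_eq_one`,
  `pos_and_lt_one_of_deriv_smoothTransition_ne_zero`, `integrable_deriv_smoothTransition_mul_sq`, `integral_deriv_smoothTransition_mul_sq_nonneg`).

READING for K1b.  The volume flux of `w − c` through a plane orthogonal to the far field equals `−E/(2c₂)` and is conserved:
either the residue object has a slab `{a < x₂ < b}` with `∫‖w − c‖² = ∞` ("flat" tail), or it is a BI-INFINITE JET carrying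
the same window energy `E₀ > 0` through every unit window of planes, above and below the core (`E₀ = 0` forces `w ≡ c`).
g3's `L²` Liouville and g4's decay-gap Liouville are the cases `∫E < ∞`, `E → 0`; new corollaries are in
`…ConstantSpeedEnergyFluxLiouville`.

WHAT THIS IS NOT: K1b is NOT proved; the jet alternative is not excluded; nothing here proves NS regularity. [folklore]
-/

noncomputable section

open Set Filter Topology MeasureTheory Metric Function
open scoped ENNReal NNReal Topology InnerProductSpace RealInnerProductSpace ContDiff
open Literature.Analysis.FluidPDE Literature.Analysis

namespace Summit.NavierStokesRegularity.NavierStokesRegularity.Theorems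

-- the problem directory repeats the summit name (`NavierStokesRegularity/NavierStokesRegularity`)
set_option linter.dupNamespace false

namespace ExtremiserLiouville

variable {V : EuclideanSpace ℝ (Fin 3) → EuclideanSpace ℝ (Fin 3)} {c : EuclideanSpace ℝ (Fin 3)}

/-! ## Facts about the smooth step `H = Real.smoothTransition` (the window weight is `H′ ≥ 0`, supported in `[0,1]`, unit mass) -/

/-- There is a point of `(0,1)` where `H′ = 1` (mean value theorem, `H(0) = 0`, `H(1) = 1`). [folklore] -/
theorem exists_deriv_smoothTransition_eq_one : ∃ u ∈ Ioo (0 : ℝ) 1, deriv Real.smoothTransition u = 1 := by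
  have hdiff : Differentiable ℝ Real.smoothTransition := Literature.Analysis.Calculus.differentiable_smoothTransition
  obtain ⟨u, hu, h⟩ := exists_deriv_eq_slope Real.smoothTransition zero_lt_one hdiff.continuous.continuousOn
    (hdiff.differentiableOn.mono Ioo_subset_Icc_self)
  refine ⟨u, hu, ?_⟩
  rw [h, Real.smoothTransition.one, Real.smoothTransition.zero]
  norm_num

/-! ## The limit `ρ → ∞`: `∫ θ′(x₂) ‖V‖² = 0` -/

/-- **Energy-flux identity.**  For `V ∈ C¹` divergence free with `⟪V, c⟫ = −‖V‖²/2`, `c₀ = c₁ = 0 ≠ c₂`, any axial test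
`θ ∈ C¹(ℝ)` vanishing on `T ≤ |s|`, and `‖V‖² ∈ L¹({|x₂| ≤ T})`: **`∫ θ′(x₂) ‖V x‖² dx = 0`** — the `θ′`-weighted average of
the plane energies `z ↦ ∫_{ℝ²}‖V(·,z)‖²` vanishes, i.e. (formally) the plane energy does not depend on the plane. [folklore] -/
theorem integral_deriv_axialTest_mul_sq_eq_zero (hV : ContDiff ℝ 1 V) (hdiv : VectorCalculus.IsDivFree V)
    (hVc : ∀ x, ⟪V x, c⟫ = -(‖V x‖ ^ 2 / 2)) (hc0 : c 0 = 0) (hc1 : c 1 = 0) (hc2 : c 2 ≠ 0)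
    {θ : ℝ → ℝ} (hθ : ContDiff ℝ 1 θ) {T : ℝ} (hT : 0 < T) (hθT : ∀ s, T ≤ |s| → θ s = 0)
    (hL2 : Integrable (fun x => {x : EuclideanSpace ℝ (Fin 3) | |x 2| ≤ T}.indicator (fun x => ‖V x‖ ^ 2) x) volume) :
    ∫ x, deriv θ (x 2) * ‖V x‖ ^ 2 = 0 := by
  obtain ⟨K, hK, hest⟩ := abs_integral_deriv_axialTest_cutoff_mul_sq_le hV hdiv hVc hc0 hc1 hc2 hθ hT hθT hL2
  obtain ⟨A, hA, -, hθ'A, hθ'supp⟩ := exists_bound_axialTest hθ hθT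
  set e₂ : EuclideanSpace ℝ (Fin 3) := EuclideanSpace.single (2 : Fin 3) (1 : ℝ) with he₂
  set SL : Set (EuclideanSpace ℝ (Fin 3)) := {x | |x 2| ≤ T} with hSL
  set F : EuclideanSpace ℝ (Fin 3) → ℝ := fun x => SL.indicator (fun x => ‖V x‖ ^ 2) x with hF
  have hF0 : ∀ x, 0 ≤ F x := fun x => by simp only [hF]; exact indicator_nonneg (fun _ _ => sq_nonneg _) _
  have hfar_meas : ∀ ρ : ℝ, MeasurableSet {x : EuclideanSpace ℝ (Fin 3) | ρ ≤ ‖x‖} := fun ρ =>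
    (isClosed_le continuous_const continuous_norm).measurableSet
  -- Step 1: the tail of `F` tends to zero
  have htail : Tendsto (fun ρ : ℝ => ∫ x in {x : EuclideanSpace ℝ (Fin 3) | ρ ≤ ‖x‖}, F x) atTop (𝓝 0) := by
    have h : Tendsto (fun ρ : ℝ => ∫ x, {x : EuclideanSpace ℝ (Fin 3) | ρ ≤ ‖x‖}.indicator F x)
        atTop (𝓝 (∫ _x : EuclideanSpace ℝ (Fin 3), (0 : ℝ))) := by
      refine tendsto_integral_filter_of_dominated_convergence F ?_ ?_ hL2 ?_
      · exact Eventually.of_forall fun ρ => (hL2.indicator (hfar_meas ρ)).aestronglyMeasurable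
      · refine Eventually.of_forall fun ρ => Eventually.of_forall fun x => ?_
        rw [Real.norm_eq_abs, abs_of_nonneg (indicator_nonneg (fun y _ => hF0 y) _)]
        by_cases hx : x ∈ {x : EuclideanSpace ℝ (Fin 3) | ρ ≤ ‖x‖}
        · rw [indicator_of_mem hx]
        · rw [indicator_of_notMem hx]; exact hF0 x
      · refine Eventually.of_forall fun x => ?_
        refine (tendsto_const_nhds (x := (0 : ℝ))).congr' ?_
        filter_upwards [eventually_gt_atTop ‖x‖] with ρ hρ
        rw [indicator_of_notMem (show x ∉ {x : EuclideanSpace ℝ (Fin 3) | ρ ≤ ‖x‖} from fun h => (not_le.2 hρ) h)]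
    simp only [integral_zero] at h
    refine h.congr fun ρ => ?_
    exact integral_indicator (hfar_meas ρ)
  -- Step 2: the main integral converges (dominated by `A · F`)
  have hdom : ∀ x, |deriv θ (x 2) * ‖V x‖ ^ 2| ≤ A * F x := fun x => by
    by_cases hd : deriv θ (x 2) = 0
    · rw [hd, zero_mul, abs_zero]; exact mul_nonneg hA (hF0 x)
    · have hx : x ∈ SL := hθ'supp _ hd
      simp only [hF, indicator_of_mem hx]
      rw [abs_mul, abs_of_nonneg (sq_nonneg ‖V x‖)]
      exact mul_le_mul_of_nonneg_right (hθ'A _) (sq_nonneg _)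
  have hcont : Continuous fun x : EuclideanSpace ℝ (Fin 3) => deriv θ (x 2) * ‖V x‖ ^ 2 :=
    ((hθ.continuous_deriv le_rfl).comp (PiLp.continuous_apply 2 _ (2 : Fin 3))).mul (hV.continuous.norm.pow 2)
  have hχ_cont : ∀ ρ : ℝ, Continuous fun x : EuclideanSpace ℝ (Fin 3) => cutoff ρ (x - (x 2) • e₂) := fun ρ =>
    (contDiff_cutoff (n := 1) ρ).continuous.comp
      (continuous_id.sub ((PiLp.continuous_apply 2 _ (2 : Fin 3)).smul continuous_const))
  have hlim : Tendsto (fun ρ : ℝ => ∫ x, deriv θ (x 2) * cutoff ρ (x - (x 2) • e₂) * ‖V x‖ ^ 2) atTop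
      (𝓝 (∫ x, deriv θ (x 2) * ‖V x‖ ^ 2)) := by
    refine tendsto_integral_filter_of_dominated_convergence (fun x => A * F x) ?_ ?_ (hL2.const_mul A) ?_
    · refine Eventually.of_forall fun ρ => Continuous.aestronglyMeasurable ?_
      exact (((hθ.continuous_deriv le_rfl).comp (PiLp.continuous_apply 2 _ (2 : Fin 3))).mul (hχ_cont ρ)).mul
        (hV.continuous.norm.pow 2)
    · refine Eventually.of_forall fun ρ => Eventually.of_forall fun x => ?_
      rw [Real.norm_eq_abs]
      have hχ01 : 0 ≤ cutoff ρ (x - (x 2) • e₂) ∧ cutoff ρ (x - (x 2) • e₂) ≤ 1 := ⟨cutoff_nonneg _ _, cutoff_le_one _ _⟩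
      calc |deriv θ (x 2) * cutoff ρ (x - (x 2) • e₂) * ‖V x‖ ^ 2|
          = cutoff ρ (x - (x 2) • e₂) * |deriv θ (x 2) * ‖V x‖ ^ 2| := by
            rw [abs_mul, abs_mul, abs_mul, abs_of_nonneg hχ01.1]; ring
        _ ≤ 1 * |deriv θ (x 2) * ‖V x‖ ^ 2| := mul_le_mul_of_nonneg_right hχ01.2 (abs_nonneg _)
        _ ≤ A * F x := by rw [one_mul]; exact hdom x
    · refine Eventually.of_forall fun x => ?_
      refine (tendsto_const_nhds (x := deriv θ (x 2) * ‖V x‖ ^ 2)).congr' ?_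
      filter_upwards [eventually_ge_atTop ‖x - (x 2) • e₂‖, eventually_gt_atTop (0 : ℝ)] with ρ hρ hρ0
      rw [cutoff_eq_one hρ0 hρ, mul_one]
  -- Step 3: pass to the limit in the estimate, for each `η > 0`
  have hle : ∀ η : ℝ, 0 < η → |∫ x, deriv θ (x 2) * ‖V x‖ ^ 2| ≤ K * (T / η) := by
    intro η hη
    have hup : Tendsto (fun ρ : ℝ => K * (η * (∫ x in {x : EuclideanSpace ℝ (Fin 3) | ρ ≤ ‖x‖}, F x) + T / η)) atTop
        (𝓝 (K * (η * 0 + T / η))) :=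
      ((htail.const_mul η).add tendsto_const_nhds).const_mul K
    rw [mul_zero, zero_add] at hup
    exact le_of_tendsto_of_tendsto hlim.abs hup ((eventually_gt_atTop 0).mono fun ρ hρ => hest ρ η hρ hη)
  -- Step 4: `η → ∞`
  have hzero : |∫ x, deriv θ (x 2) * ‖V x‖ ^ 2| ≤ 0 := by
    refine le_of_forall_pos_le_add fun ε hε => ?_
    have hη : 0 < (K * T + 1) / ε := by positivity
    have h := hle _ hη
    have hKT : K * (T / ((K * T + 1) / ε)) ≤ ε := by
      rw [div_div_eq_mul_div, mul_div_assoc', div_le_iff₀ (by positivity)]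
      nlinarith [hK, hT.le, hε]
    linarith
  exact abs_eq_zero.1 (le_antisymm hzero (abs_nonneg _))

/-! ## The window weight `H′(x₂ − r)` -/

/-- `H′(u) ≠ 0 ⇒ 0 < u < 1` (the window weight lives on the unit window). [folklore] -/
theorem pos_and_lt_one_of_deriv_smoothTransition_ne_zero {u : ℝ} (hu : deriv Real.smoothTransition u ≠ 0) :
    0 < u ∧ u < 1 := by
  constructor
  · by_contra h; exact hu (Literature.Analysis.Calculus.deriv_smoothTransition_of_nonpos (not_lt.1 h))
  · by_contra h; exact hu (Literature.Analysis.Calculus.deriv_smoothTransition_of_one_le (not_lt.1 h))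

/-- The window density `H′(x₂ − r)‖V x‖²` is integrable as soon as `‖V‖² ∈ L¹({|x₂| ≤ T})` with `|r| + 1 ≤ T`
(`V` continuous). [folklore] -/
theorem integrable_deriv_smoothTransition_mul_sq (hV : Continuous V) {T r : ℝ} (hr : |r| + 1 ≤ T)
    (hL2 : Integrable (fun x => {x : EuclideanSpace ℝ (Fin 3) | |x 2| ≤ T}.indicator (fun x => ‖V x‖ ^ 2) x) volume) :
    Integrable (fun x : EuclideanSpace ℝ (Fin 3) => deriv Real.smoothTransition (x 2 - r) * ‖V x‖ ^ 2) volume := by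
  obtain ⟨A, hA, hHA⟩ := Literature.Analysis.Calculus.exists_bound_deriv_smoothTransition
  refine (hL2.const_mul A).mono' ?_ (Eventually.of_forall fun x => ?_)
  · exact (((Real.smoothTransition.contDiff.continuous_deriv le_rfl).comp
      ((PiLp.continuous_apply 2 _ (2 : Fin 3)).sub continuous_const)).mul (hV.norm.pow 2)).aestronglyMeasurable
  · rw [Real.norm_eq_abs]
    by_cases hd : deriv Real.smoothTransition (x 2 - r) = 0
    · rw [hd, zero_mul, abs_zero]; exact mul_nonneg hA (indicator_nonneg (fun _ _ => sq_nonneg _) _)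
    · obtain ⟨hl, hu⟩ := pos_and_lt_one_of_deriv_smoothTransition_ne_zero hd
      have hx : x ∈ {x : EuclideanSpace ℝ (Fin 3) | |x 2| ≤ T} := by
        show |x 2| ≤ T
        rw [abs_le]; constructor <;> linarith [le_abs_self r, neg_abs_le r]
      rw [indicator_of_mem hx, abs_mul, abs_of_nonneg (sq_nonneg ‖V x‖)]
      exact mul_le_mul_of_nonneg_right (hHA _) (sq_nonneg _)

/-- The window energy is nonnegative. [folklore] -/
theorem integral_deriv_smoothTransition_mul_sq_nonneg (r : ℝ) :
    0 ≤ ∫ x : EuclideanSpace ℝ (Fin 3), deriv Real.smoothTransition (x 2 - r) * ‖V x‖ ^ 2 :=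
  integral_nonneg fun _ => mul_nonneg (Real.smoothTransition.monotone.deriv_nonneg) (sq_nonneg _)

/-! ## Window energies are translation invariant along the far-field axis -/

/-- **ENERGY-FLUX INVARIANCE.**  For `V ∈ C¹` divergence free with `⟪V, c⟫ = −‖V‖²/2`, `c = (0,0,c₂) ≠ 0`, and
`‖V‖² ∈ L¹({|x₂| ≤ T})`: the WINDOW ENERGIES `E(s) = ∫ H′(x₂ − s)‖V x‖² dx` (`H = Real.smoothTransition`; `H′ ≥ 0` has unit
mass on `[0,1]`, so `E(s)` is an average of the plane energies `∫_{ℝ²}‖V(·,z)‖²` over `s ≤ z ≤ s+1`) satisfy **`E(s) = E(t)`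
for all `|s| + 1 ≤ T`, `|t| + 1 ≤ T`**.  Physically: the volume flux of `w − c` through a plane orthogonal to the far field is
`−E/(2c₂)`, and `div (w − c) = 0` conserves it. [folklore] -/
theorem integral_deriv_smoothTransition_mul_sq_eq (hV : ContDiff ℝ 1 V) (hdiv : VectorCalculus.IsDivFree V)
    (hVc : ∀ x, ⟪V x, c⟫ = -(‖V x‖ ^ 2 / 2)) (hc0 : c 0 = 0) (hc1 : c 1 = 0) (hc2 : c 2 ≠ 0)
    {T s t : ℝ} (hs : |s| + 1 ≤ T) (ht : |t| + 1 ≤ T)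
    (hL2 : Integrable (fun x => {x : EuclideanSpace ℝ (Fin 3) | |x 2| ≤ T}.indicator (fun x => ‖V x‖ ^ 2) x) volume) :
    (∫ x, deriv Real.smoothTransition (x 2 - s) * ‖V x‖ ^ 2) =
      ∫ x, deriv Real.smoothTransition (x 2 - t) * ‖V x‖ ^ 2 := by
  set θ : ℝ → ℝ := fun z => Real.smoothTransition (z - s) - Real.smoothTransition (z - t) with hθdef
  have hHd : ContDiff ℝ 1 Real.smoothTransition := Real.smoothTransition.contDiff
  have hθ : ContDiff ℝ 1 θ :=
    (hHd.comp (contDiff_id.sub contDiff_const)).sub (hHd.comp (contDiff_id.sub contDiff_const))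
  have hT : 0 < T := by linarith [abs_nonneg s]
  have hθT : ∀ z, T ≤ |z| → θ z = 0 := by
    intro z hz
    rcases le_abs'.1 hz with h | h
    · -- `z ≤ -T`: both steps vanish
      have h1 : z - s ≤ 0 := by linarith [neg_abs_le s]
      have h2 : z - t ≤ 0 := by linarith [neg_abs_le t]
      show Real.smoothTransition (z - s) - Real.smoothTransition (z - t) = 0
      rw [Real.smoothTransition.zero_of_nonpos h1, Real.smoothTransition.zero_of_nonpos h2, sub_self]
    · -- `T ≤ z`: both steps equal one
      have h1 : 1 ≤ z - s := by linarith [le_abs_self s]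
      have h2 : 1 ≤ z - t := by linarith [le_abs_self t]
      show Real.smoothTransition (z - s) - Real.smoothTransition (z - t) = 0
      rw [Real.smoothTransition.one_of_one_le h1, Real.smoothTransition.one_of_one_le h2, sub_self]
  have hdiffH : Differentiable ℝ Real.smoothTransition := Literature.Analysis.Calculus.differentiable_smoothTransition
  have hderiv : ∀ z, deriv θ z = deriv Real.smoothTransition (z - s) - deriv Real.smoothTransition (z - t) := by
    intro z
    have h1 : DifferentiableAt ℝ (fun z => Real.smoothTransition (z - s)) z :=
      (hdiffH _).comp z (differentiableAt_id.sub_const s)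
    have h2 : DifferentiableAt ℝ (fun z => Real.smoothTransition (z - t)) z :=
      (hdiffH _).comp z (differentiableAt_id.sub_const t)
    show deriv (fun z => Real.smoothTransition (z - s) - Real.smoothTransition (z - t)) z = _
    rw [deriv_fun_sub h1 h2, deriv_comp_sub_const, deriv_comp_sub_const]
  have h0 := integral_deriv_axialTest_mul_sq_eq_zero hV hdiv hVc hc0 hc1 hc2 hθ hT hθT hL2
  simp_rw [hderiv, sub_mul] at h0
  -- integrability of the two window densities (dominated by `A · 𝟙_{|x₂| ≤ T} ‖V‖²`)
  rw [integral_sub (integrable_deriv_smoothTransition_mul_sq hV.continuous hs hL2)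
    (integrable_deriv_smoothTransition_mul_sq hV.continuous ht hL2)] at h0
  linarith

end ExtremiserLiouville

end Summit.NavierStokesRegularity.NavierStokesRegularity.Theorems

end
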